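import Summits.HodgeConjecture.HodgeConjecture.Theorems.Ring2WeilCoverageFrameFreePlacementD
import HarnessLib

/-!
# Weil-type family coverage — frame-free placement F: the second `2I` family, the tier-2 `5`-class triangles, and more Schur-index-one rows

research route conditional on HC_CM; not a corollary; Q11.4-sentence-2 already refuted in dim ≥ 3.

Ring 2, WEIL-TYPE FAMILY-COVERAGE CENSUS (`HOME/WEIL-FAMILY-COVERAGE.md` `## b04`, block b04.11 P.S., owner ring2-b04);
sixth part of `Ring2WeilCoverageFrameFreePlacement{,B,C,D,E}` (imports part D only, so that it is independent of part E's
verdict; no name is shared with part E).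

* §1 the SECOND one-parameter family of `2I`-curves with an EIGHTFOLD `ℍ_ℚ ⊗ ℚ(√5)`-piece: `(0; 3,3,5,2)` (classes
  `c3, c3, c5, z`; genus 39; `k = 2`), `C = 1/101250000 = 5·(1/22500)²` — `≡ 5` as the law `C ≡ 5^{#c5}` PREDICTED —
  NON-split on `(4, ℚ(√-d), [5])` at the eleven census fields with `5 ∉ Nm` (kit j184755);
* §2 the tier-2 TRIANGLE CM fourfolds with `C ≡ 5`: `(0; 4,5′,10′)` (genus 28, `C = 1/1620 = 5·(1/90)²`) and
  `(0; 5′,6,10′)` (genus 33, `C = 1/10125 = 5·(1/225)²`) — the same eleven non-split `5`-rows at `g = 4` as Klein's `X₁₄`;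
* §3 Schur-index-ONE rows (THEOREM S1 of the census: the piece is `W ⊗_K M`, `H = h_W ⊗ β`, `det H ≡ det(h_W)^m det(β)^d`
  modulo norms, so an even-degree character forces the split class): the `PSL₂(𝔽₇)` Weil-sixfold FAMILIES `(0; 2,2,3,4)`
  (genus 36, `det H = -1/3136 = -(1/56)²`) and `(0; 2,3,3,3)` (genus 43, `det H = -2/343`, `2/343 = (1/14)² + 7·(1/98)²`) on
  `W6.7.1`, and the RIGID `GL₂(𝔽₃)`-curve `(0; 6,8,8′)` (genus 15; the two faithful degree-2 characters with values `±√-2`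
  on the classes of order 8): a Weil-type FOURFOLD with `ℚ(√-2)` through the group algebra, `det H = 2/27 = (2/9)² + 2·(1/9)²`
  ⟹ `W4.2.1`, split — as S1 predicts for `d = 2` (and as THEOREM S2 — Navarro–Tiep: no odd-degree character has field
  `ℚ(√-2)` — predicts for EVERY Schur-index-one piece over `ℚ(√-2)`).

No `def`, no named fact, no `sorry`; nothing here is a statement about Hodge classes; `HC_CM` is used nowhere.

References: [cite: vanGeemen1994HodgeAV, 5.4 and (5.4.1)]; [cite: Serre1973, Ch. III §1]; [cite: NavarroTiep2021, Thm. A1–A2].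
-/

noncomputable section

set_option linter.dupNamespace false

open Literature.AlgebraicGeometry.Motives
open Literature.AlgebraicGeometry.VanGeemen1994
open Summit.HodgeConjecture.HodgeConjecture.Ring2.Hypotheses

namespace Summit.HodgeConjecture.HodgeConjecture.Ring2.WeilCoverage

/-! ### §1 The second `2I` eightfold family `(0; 3,3,5,2)` -/

/-- **Frame-free class of the `2I` eightfold FAMILY `(0; 3,3,5,2)`** (genus 39, `k = 2`, Hurwitz dimension 1):
`C = 1/101250000 = 5·(1/22500)²`: split component iff `5 ∈ Nm(ℚ(√-d)ˣ)`, for every member and every `K = ℚ(√-d)`.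
research route conditional on HC_CM; not a corollary; Q11.4-sentence-2 already refuted in dim ≥ 3. [cite: vanGeemen1994HodgeAV, (5.4.1)] -/
theorem eightfold_icosahedralFamily3352_mk_C_eq_split_iff (d : ℕ) :
    (QuotientGroup.mk (Units.mk0 ((1 : ℚ) / 101250000) (by norm_num)) : weilNormResidueGroup d) =
      splitDiscriminantClass 4 d ↔ Units.mk0 (5 : ℚ) (by norm_num) ∈ normUnitsSubgroup ℚ (weilField d) :=
  mk_eq_split_iff_of_eq_mul_norm_mul_sq (n := 4) (by decide) (a := (1 : ℚ) / 101250000) (C := 5) (ν := 1)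
    (s := (1 : ℚ) / 22500) (by norm_num) (by norm_num) one_ne_zero (by norm_num) (by norm_num) (one_mem_normUnitsSubgroup d)

/-- The family `(0; 3,3,5,2)` lies on `W8.3.5 = (4, ℚ(√-3), 5)` — a second positive-dimensional family with a curve (genus 39,
`2I`-action, `ℍ_ℚ ⊗ ℚ(√5)`-multiplication) on that non-split row. research route conditional on HC_CM; not a corollary; Q11.4-sentence-2 already refuted in dim ≥ 3. [cite: vanGeemen1994HodgeAV, (5.4.1)] -/
theorem eightfold_sqrtNeg3_icosahedralFamily3352_ne_split :
    (QuotientGroup.mk (Units.mk0 ((1 : ℚ) / 101250000) (by norm_num)) : weilNormResidueGroup 3) ≠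
      splitDiscriminantClass 4 3 := fun h =>
  Summit.HodgeConjecture.Ring2WeilNormDescent.five_not_mem_norm_three
    ((eightfold_icosahedralFamily3352_mk_C_eq_split_iff 3).1 h)

/-- The family `(0; 3,3,5,2)` on `W8.2.5`. research route conditional on HC_CM; not a corollary; Q11.4-sentence-2 already refuted in dim ≥ 3. [cite: vanGeemen1994HodgeAV, (5.4.1)] -/
theorem eightfold_sqrtNeg2_icosahedralFamily3352_ne_split :
    (QuotientGroup.mk (Units.mk0 ((1 : ℚ) / 101250000) (by norm_num)) : weilNormResidueGroup 2) ≠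
      splitDiscriminantClass 4 2 := fun h =>
  Summit.HodgeConjecture.Ring2WeilNormDescent.five_not_mem_norm_two
    ((eightfold_icosahedralFamily3352_mk_C_eq_split_iff 2).1 h)

/-- The family `(0; 3,3,5,2)` on `W8.7.5`. research route conditional on HC_CM; not a corollary; Q11.4-sentence-2 already refuted in dim ≥ 3. [cite: vanGeemen1994HodgeAV, (5.4.1)] -/
theorem eightfold_sqrtNeg7_icosahedralFamily3352_ne_split :
    (QuotientGroup.mk (Units.mk0 ((1 : ℚ) / 101250000) (by norm_num)) : weilNormResidueGroup 7) ≠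
      splitDiscriminantClass 4 7 := fun h =>
  Summit.HodgeConjecture.Ring2WeilNormDescent.five_not_mem_norm_seven
    ((eightfold_icosahedralFamily3352_mk_C_eq_split_iff 7).1 h)

/-! ### §2 The tier-2 `2I` triangle CM fourfolds with `C ≡ 5` -/

/-- `(0; 4,5′,10′)` (genus 28; `k = 1`, a CM fourfold by the CM LEMMA): `C = 1/1620 = 5·(1/90)²`: split iff `5 ∈ Nm(ℚ(√-d)ˣ)`.
research route conditional on HC_CM; not a corollary; Q11.4-sentence-2 already refuted in dim ≥ 3. [cite: vanGeemen1994HodgeAV, (5.4.1)] -/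
theorem fourfold_icosahedral4510_mk_C_eq_split_iff (d : ℕ) :
    (QuotientGroup.mk (Units.mk0 ((1 : ℚ) / 1620) (by norm_num)) : weilNormResidueGroup d) =
      splitDiscriminantClass 2 d ↔ Units.mk0 (5 : ℚ) (by norm_num) ∈ normUnitsSubgroup ℚ (weilField d) :=
  mk_eq_split_two_iff_five_mem (s := (1 : ℚ) / 90) (by norm_num) (by norm_num) (by norm_num)

/-- `(0; 5′,6,10′)` (genus 33; CM fourfold): `C = 1/10125 = 5·(1/225)²`: split iff `5 ∈ Nm(ℚ(√-d)ˣ)`.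
research route conditional on HC_CM; not a corollary; Q11.4-sentence-2 already refuted in dim ≥ 3. [cite: vanGeemen1994HodgeAV, (5.4.1)] -/
theorem fourfold_icosahedral5610_mk_C_eq_split_iff (d : ℕ) :
    (QuotientGroup.mk (Units.mk0 ((1 : ℚ) / 10125) (by norm_num)) : weilNormResidueGroup d) =
      splitDiscriminantClass 2 d ↔ Units.mk0 (5 : ℚ) (by norm_num) ∈ normUnitsSubgroup ℚ (weilField d) :=
  mk_eq_split_two_iff_five_mem (s := (1 : ℚ) / 225) (by norm_num) (by norm_num) (by norm_num)

/-- `(0; 4,5′,10′)` lies on `W4.3.5` next to Klein's `X₁₄`. research route conditional on HC_CM; not a corollary; Q11.4-sentence-2 already refuted in dim ≥ 3. [cite: vanGeemen1994HodgeAV, (5.4.1)] -/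
theorem fourfold_sqrtNeg3_icosahedral4510_ne_split :
    (QuotientGroup.mk (Units.mk0 ((1 : ℚ) / 1620) (by norm_num)) : weilNormResidueGroup 3) ≠
      splitDiscriminantClass 2 3 := fun h =>
  Summit.HodgeConjecture.Ring2WeilNormDescent.five_not_mem_norm_three ((fourfold_icosahedral4510_mk_C_eq_split_iff 3).1 h)

/-- `(0; 5′,6,10′)` lies on `W4.3.5`. research route conditional on HC_CM; not a corollary; Q11.4-sentence-2 already refuted in dim ≥ 3. [cite: vanGeemen1994HodgeAV, (5.4.1)] -/
theorem fourfold_sqrtNeg3_icosahedral5610_ne_split :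
    (QuotientGroup.mk (Units.mk0 ((1 : ℚ) / 10125) (by norm_num)) : weilNormResidueGroup 3) ≠
      splitDiscriminantClass 2 3 := fun h =>
  Summit.HodgeConjecture.Ring2WeilNormDescent.five_not_mem_norm_three ((fourfold_icosahedral5610_mk_C_eq_split_iff 3).1 h)

/-! ### §3 More Schur-index-one rows: `PSL₂(𝔽₇)` families at genus 36, 43 and the rigid `GL₂(𝔽₃)` fourfold -/

/-- **`PSL₂(𝔽₇)`-curves `(0; 2,2,3,4)` (genus 36; family)**: `η`-piece `m = 2`, signature `(3,3)`, `det H = -1/3136 = -(1/56)²`: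
`W6.7.1`. research route conditional on HC_CM; not a corollary; Q11.4-sentence-2 already refuted in dim ≥ 3. [cite: vanGeemen1994HodgeAV, (5.4.1)] -/
theorem sixfold_psl27_family2234_mk_detH_eq_split :
    (QuotientGroup.mk (Units.mk0 ((-1 : ℚ) / 3136) (by norm_num)) : weilNormResidueGroup 7) =
      splitDiscriminantClass 3 7 := by
  have e : Units.mk0 ((-1 : ℚ) / 3136) (by norm_num) = -(Units.mk0 ((1 : ℚ) / 3136) (by norm_num)) :=
    Units.ext (by norm_num)
  rw [e, mk_neg_eq_splitDiscriminantClass_iff_of_odd (n := 3) (by decide)]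
  exact mem_normUnitsSubgroup_of_sq_add_mul_sq _ ((1 : ℚ) / 56) (0 : ℚ) (by norm_num)

/-- **`PSL₂(𝔽₇)`-curves `(0; 2,3,3,3)` (genus 43; family)**: `m = 2`, signature `(3,3)`, `det H = -2/343`,
`a = 2/343 = (1/14)² + 7·(1/98)²`: `W6.7.1`. research route conditional on HC_CM; not a corollary; Q11.4-sentence-2 already refuted in dim ≥ 3. [cite: vanGeemen1994HodgeAV, (5.4.1)] -/
theorem sixfold_psl27_family2333_mk_detH_eq_split :
    (QuotientGroup.mk (Units.mk0 ((-2 : ℚ) / 343) (by norm_num)) : weilNormResidueGroup 7) =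
      splitDiscriminantClass 3 7 := by
  have e : Units.mk0 ((-2 : ℚ) / 343) (by norm_num) = -(Units.mk0 ((2 : ℚ) / 343) (by norm_num)) :=
    Units.ext (by norm_num)
  rw [e, mk_neg_eq_splitDiscriminantClass_iff_of_odd (n := 3) (by decide)]
  exact mem_normUnitsSubgroup_of_sq_add_mul_sq _ ((1 : ℚ) / 14) ((1 : ℚ) / 98) (by norm_num)

/-- **The RIGID `GL₂(𝔽₃)`-curve `(0; 6,8,8′)` (genus 15)**: the piece of the two faithful degree-2 characters (`ℚ(χ) = ℚ(√-2)`,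
Schur index 1) has `m = 2`, `K`-signature `(2,2)` — a rigid Weil-type FOURFOLD with `ℚ(√-2)` through the group algebra
(Bolza's curve `(0; 2,3,8)` is the control: `m = 1`, signature `(2,0)`, `J ~ E²` definite) — `det H = 2/27 = (2/9)² + 2·(1/9)²`,
a norm: row `W4.2.1`, SPLIT, as THEOREM S1 (`d = 2`) and THEOREM S2 (Navarro–Tiep) require over `ℚ(√-2)`.
research route conditional on HC_CM; not a corollary; Q11.4-sentence-2 already refuted in dim ≥ 3. [cite: NavarroTiep2021, Thm. A1–A2] -/
theorem fourfold_gl23_688_mk_detH_eq_split :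
    (QuotientGroup.mk (Units.mk0 ((2 : ℚ) / 27) (by norm_num)) : weilNormResidueGroup 2) =
      splitDiscriminantClass 2 2 :=
  (mk_eq_splitDiscriminantClass_iff_of_even (n := 2) (by decide) _).2
    (mem_normUnitsSubgroup_of_sq_add_mul_sq _ ((2 : ℚ) / 9) ((1 : ℚ) / 9) (by norm_num))

end Summit.HodgeConjecture.HodgeConjecture.Ring2.WeilCoverage

end
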